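import Summits.CriticalPhenomena.PercolationContinuityZ3.Theorems.PercNearOneGluingNoHeavyLowerTailHullPortCSHWorld
import Summits.CriticalPhenomena.PercolationContinuityZ3.Theorems.PercNearOneGluingNoHeavyLowerTailGuardedLonelyRelay
import Literature.Probability.Percolation.TwoSetConditionalAssociation
import HarnessLib

/-!
# `NoHeavyLowerTail` (stmt-CriticalPhenomena-4575) — conditioned slack hierarchy: Lemma Φ(b), set-4PT (edge form), the H-part

Support file (prover `prim-ineq-prove-5`; `--supports stmt-CriticalPhenomena-4575`); no definitions, named facts or sorries.
Pieces of prim-hp-8's programme (memo run/shared/lean/prim/prim-hp-8/PROOF-S5-ALL-R.md §2–§3, socket SOCKET-CSH-LEAN.md) at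
level `k = 1`, in the `delE`/`cut` bookkeeping of `…HullPortTADefs` / `…HullPortCSHDefs`:
* `HullPort.cshPhi_mono` — Lemma Φ(b): hp-8's functional `Φ` is monotone (pointwise coupling);
* `HullPort.setFourPT_edge` — (K6) "set-4PT" for monotone functions of the open EDGE cluster of `x ∈ S`:
  `μ(D∩{o↔v})·(∫_{v↔S}F − μ(v↔S)∫F) ≤ μ(D)·(∫_{o↔S}F − μ(o↔S)∫F)`, `D = {v ↮ S}` (Harris + the two-set negative
  correlation of van den Berg–Häggström–Kahn, `BHK2006_twoSetConditionalAssociation.negCorrelation`);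
* `HullPort.world_setFourPT`, `HullPort.hpart_nonneg` — set-4PT in every world `G − cut_Y(ω)` (`delE` form, weights zeroed on the cut)
  and hp-8's Lemma H at `k = 1`: the H-part is `≥ 0` given the diagonal A2/T_A inequality (Htw), taken as a hypothesis.
[cite: VandenbergHaggstromKahn2005, Thm. 1.5 (p. 7) with Remark 1 after Thm. 1.2 (p. 5); §2.1 Lemmas 2.3–2.4 (p. 10) — corollaries]
-/

noncomputable section

namespace Summit.CriticalPhenomena.PercolationContinuityZ3.Theorems

open MeasureTheory Set Literature.Probability.LatticeModels Literature.Probability.Percolation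
open scoped Classical

variable {V : Type*}

namespace HullPort

open LonePortSum LonePortSumGeneral BHK2006 DecisionTree KNPreFKG

section CSHCell

variable [Fintype V]

/-! ### Lemma Φ(b): `Φ` is monotone -/

omit [Fintype V] in
/-- `cut` is monotone in the configuration. [folklore] -/
theorem cut_mono (Y : Set V) {ζ ζ' : Set (Sym2 V)} (h : ζ ⊆ ζ') : cut Y ζ ⊆ cut Y ζ' := by
  rintro e ⟨v, hv, y, hy, hyv⟩
  exact ⟨v, hv, y, hy, hyv.mono (openGraph_le h)⟩

omit [Fintype V] in
/-- `barOf` is monotone in the edge set. [folklore] -/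
theorem barOf_mono (S : Set V) {W W' : Set (Sym2 V)} (h : W ⊆ W') : barOf S W ⊆ barOf S W' := by
  rintro e ⟨v, hv, hS | ⟨e', he', hve'⟩⟩
  · exact ⟨v, hv, Or.inl hS⟩
  · exact ⟨v, hv, Or.inr ⟨e', h he', hve'⟩⟩

omit [Fintype V] in
/-- **Lemma Φ(b), pointwise**: the integrand of `Φ` is monotone in the deleted pair set. For `B ⊆ B'`:
`1{x↮Y}(η∖B)(Ψ(C_x(η∖cut_Y(η∖B))) − Ψ(C_x(η∖B))) ≤ 1{x↮Y}(η∖B')(Ψ(C_x(η∖cut_Y(η∖B'))) − Ψ(C_x(η∖B')))`.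
(transcription of the cell memo prim-hp-8 PROOF-S5-ALL-R.md §3.2(b)) [folklore] -/
theorem phiIntegrand_mono (x : V) (Y : Set V) (Ψ : Set (Sym2 V) → ℝ) (hΨ : Monotone Ψ) {B B' : Set (Sym2 V)}
    (hBB : B ⊆ B') (η : Set (Sym2 V)) :
    ind (avoidEv x Y) (η \ B) * (Ψ (openEdgeCluster (η \ cut Y (η \ B)) x) - Ψ (openEdgeCluster (η \ B) x)) ≤
      ind (avoidEv x Y) (η \ B') * (Ψ (openEdgeCluster (η \ cut Y (η \ B')) x) - Ψ (openEdgeCluster (η \ B') x)) := by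
  have hsub : η \ B' ⊆ η \ B := Set.sdiff_subset_sdiff_right hBB
  -- nonnegativity of the `B'` integrand
  have hnn : 0 ≤ ind (avoidEv x Y) (η \ B') *
      (Ψ (openEdgeCluster (η \ cut Y (η \ B')) x) - Ψ (openEdgeCluster (η \ B') x)) := by
    by_cases h : η \ B' ∈ avoidEv x Y
    · rw [ind_of_mem h, one_mul, sub_nonneg]
      have e := openEdgeCluster_sdiff_cut_of_avoid Y (η \ B') (a := x) (fun y hy hyx => h y hy hyx.symm)
      rw [← e]
      exact hΨ (openEdgeCluster_mono (Set.sdiff_subset_sdiff_left Set.sdiff_subset) x)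
    · rw [ind_of_not_mem h, zero_mul]
  by_cases hB : η \ B ∈ avoidEv x Y
  · have hB' : η \ B' ∈ avoidEv x Y := fun y hy hxy => hB y hy (hxy.mono (openGraph_le hsub))
    rw [ind_of_mem hB, ind_of_mem hB', one_mul, one_mul]
    have h1 : Ψ (openEdgeCluster (η \ cut Y (η \ B)) x) ≤ Ψ (openEdgeCluster (η \ cut Y (η \ B')) x) :=
      hΨ (openEdgeCluster_mono (Set.sdiff_subset_sdiff_right (cut_mono Y hsub)) x)
    have h2 : Ψ (openEdgeCluster (η \ B') x) ≤ Ψ (openEdgeCluster (η \ B) x) := hΨ (openEdgeCluster_mono hsub x)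
    linarith
  · rw [ind_of_not_mem hB, zero_mul]
    exact hnn

/-- **Lemma Φ(b)**: `Φ = cshPhi w x d Y Ψ` is monotone in the edge cluster (for weights in `[0,1]` and `Ψ` monotone).
(transcription of the cell memo prim-hp-8 PROOF-S5-ALL-R.md §3.2(b)) [folklore] -/
theorem cshPhi_mono (w : Sym2 V → ℝ) (hw0 : ∀ e, 0 ≤ w e) (hw1 : ∀ e, w e ≤ 1) (x d : V) (Y : Set V)
    (Ψ : Set (Sym2 V) → ℝ) (hΨ : Monotone Ψ) : Monotone (cshPhi w x d Y Ψ) := by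
  intro C C' hCC'
  unfold cshPhi
  refine Finset.sum_le_sum fun η _ => mul_le_mul_of_nonneg_left ?_ (weight_nonneg hw0 hw1 η)
  exact phiIntegrand_mono x Y Ψ hΨ (barOf_mono {d} hCC') η

/-! ### Set-4PT for functions of the open EDGE cluster (K6, edge version) -/

omit [Fintype V] in
/-- The cluster of `x ∈ S` is read off the union cluster `C_S`. [folklore] -/
theorem openEdgeCluster_biUnion_eq (ω : BondConfig V) (S : Set V) {x : V} (hx : x ∈ S) :
    openEdgeCluster (⋃ s ∈ S, openEdgeCluster ω s) x = openEdgeCluster ω x := by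
  have hsub : (⋃ s ∈ S, openEdgeCluster ω s) ⊆ ω := Set.iUnion₂_subset fun s _ => openEdgeCluster_subset ω s
  apply Set.Subset.antisymm (openEdgeCluster_mono hsub x)
  intro e he
  obtain ⟨heω, hd, hr⟩ := (mem_openEdgeCluster_iff _ _ _).1 he
  refine (mem_openEdgeCluster_iff _ _ _).2 ⟨Set.mem_biUnion hx he, hd, fun v hv => ?_⟩
  exact (GuardedLonelyRelay.reachable_fromEdgeSet_openEdgeCluster (hr v hv)).mono
    (SimpleGraph.fromEdgeSet_mono (Set.subset_biUnion_of_mem hx))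

/-- **Set-4PT, edge-cluster form** (hp-8's K6): for `x ∈ S`, `F` monotone nonnegative on the open edge cluster of `x`,
`D = {v ↮ S}`:  `μ(D ∩ {o↔v})·(∫_{v↔S} F − μ(v↔S)∫F) ≤ μ(D)·(∫_{o↔S} F − μ(o↔S)∫F)`.
Proof: `1{o↔S} = 1{o ↔ S∪{v}} − 1{o↔v}1_D`, Harris, and the two-set negative correlation of `F(C_x)` (increasing in `C_S`)
and `1{o ∈ C_v}` given `{S ↮ v}`.  [cite: VandenbergHaggstromKahn2005, Thm. 1.5 (p. 7) with Remark 1 after Thm. 1.2 (p. 5) — corollary] -/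
theorem setFourPT_edge (w : Sym2 V → unitInterval) (S : Set V) (o v x : V) (hx : x ∈ S)
    (F : Set (Sym2 V) → ℝ) (hF : Monotone F) (hF0 : ∀ C, 0 ≤ F C) :
    (prodBernoulli w).real ({ω : BondConfig V | ∀ s ∈ S, ¬ (openGraph ω).Reachable s v} ∩ openConn o v) *
        (∫ ω in {ω : BondConfig V | ∃ s ∈ S, (openGraph ω).Reachable s v}, F (openEdgeCluster ω x) ∂(prodBernoulli w) -
          (prodBernoulli w).real {ω : BondConfig V | ∃ s ∈ S, (openGraph ω).Reachable s v} *
            ∫ ω, F (openEdgeCluster ω x) ∂(prodBernoulli w)) ≤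
      (prodBernoulli w).real {ω : BondConfig V | ∀ s ∈ S, ¬ (openGraph ω).Reachable s v} *
        (∫ ω in {ω : BondConfig V | ∃ s ∈ S, (openGraph ω).Reachable s o}, F (openEdgeCluster ω x) ∂(prodBernoulli w) -
          (prodBernoulli w).real {ω : BondConfig V | ∃ s ∈ S, (openGraph ω).Reachable s o} *
            ∫ ω, F (openEdgeCluster ω x) ∂(prodBernoulli w)) := by
  set μ := prodBernoulli w with hμ
  have hmeas : ∀ A : Set (BondConfig V), MeasurableSet A := fun _ => MeasurableSet.of_discrete
  set f : BondConfig V → ℝ := fun ω => F (openEdgeCluster ω x) with hf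
  have hfmono : Monotone f := fun ω ω' h => hF (openEdgeCluster_mono h x)
  have hf0 : ∀ ω, 0 ≤ f ω := fun ω => hF0 _
  have hint : ∀ A : Set (BondConfig V), IntegrableOn f A μ := fun A => (Integrable.of_finite).integrableOn
  set D : Set (BondConfig V) := {ω | ∀ s ∈ S, ¬ (openGraph ω).Reachable s v} with hD
  set OS : Set (BondConfig V) := {ω | ∃ s ∈ S, (openGraph ω).Reachable s o} with hOS
  set VS : Set (BondConfig V) := {ω | ∃ s ∈ S, (openGraph ω).Reachable s v} with hVS
  set Ov : Set (BondConfig V) := openConn o v with hOv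
  -- `OS ∪ Ov`-type decomposition: `{o ↔ S ∪ {v}} = OS ⊔ (Ov ∩ D)`
  set U : Set (BondConfig V) := OS ∪ Ov with hU
  have hdisj : Disjoint OS (Ov ∩ D) := by
    rw [Set.disjoint_left]
    rintro ω ⟨s, hs, hso⟩ ⟨hov, hD'⟩
    exact hD' s hs (hso.trans hov)
  have hUeq : U = OS ∪ (Ov ∩ D) := by
    ext ω; simp only [hU, Set.mem_union, Set.mem_inter_iff]
    constructor
    · rintro (h | h)
      · exact Or.inl h
      · by_cases hD' : ω ∈ D
        · exact Or.inr ⟨h, hD'⟩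
        · left
          simp only [hD, Set.mem_setOf_eq, not_forall, not_not] at hD'
          obtain ⟨s, hs, hsv⟩ := hD'
          exact ⟨s, hs, hsv.trans (h : (openGraph ω).Reachable o v).symm⟩
    · rintro (h | ⟨h, -⟩)
      · exact Or.inl h
      · exact Or.inr h
  have hVD : VS = Dᶜ := by
    ext ω; simp only [hVS, hD, Set.mem_setOf_eq, Set.mem_compl_iff, not_forall, not_not]
    exact ⟨fun ⟨s, hs, h⟩ => ⟨s, hs, h⟩, fun ⟨s, hs, h⟩ => ⟨s, hs, h⟩⟩
  -- (1) Harris on the increasing event `U`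
  have hupOS : IsUpperSet OS := by
    intro ω ω' hle hω
    obtain ⟨s, hs, h⟩ := hω
    exact ⟨s, hs, h.mono (openGraph_le hle)⟩
  have hupU : IsUpperSet U := hupOS.union (isUpperSet_openConn o v)
  have harris : (∫ ω, f ω ∂μ) * μ.real U ≤ ∫ ω in U, f ω ∂μ := by
    have h := integral_harris w f (U.indicator 1) hfmono (monotone_indicator_one_of_isUpperSet hupU) hf0
      (fun ω => Set.indicator_nonneg (fun _ _ => zero_le_one) _)
    rw [integral_indicator_one (hmeas _)] at h
    have e : ∫ ω, f ω * U.indicator 1 ω ∂μ = ∫ ω in U, f ω ∂μ := by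
      rw [← integral_indicator (hmeas _)]
      refine integral_congr_ae (Filter.Eventually.of_forall fun ω => ?_)
      by_cases hω : ω ∈ U
      · simp [Set.indicator_of_mem hω]
      · simp [Set.indicator_of_notMem hω]
    rw [e] at h; exact h
  -- (2) two-set negative correlation given `{S ↮ v}`: `μ(D) ∫_{D ∩ Ov} f ≤ (∫_D f) μ(D ∩ Ov)`
  have hDeq : {ω : BondConfig V | ∀ s ∈ S, ∀ t ∈ ({v} : Set V), ¬ (openGraph ω).Reachable s t} = D := by
    ext ω; simp only [hD, Set.mem_setOf_eq, Set.mem_singleton_iff, forall_eq]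
  have neg := BHK2006_twoSetConditionalAssociation.negCorrelation w S ({v} : Set V)
    (fun C => F (openEdgeCluster C x)) (fun C => ind {E : Set (Sym2 V) | o = v ∨ ∃ e ∈ E, o ∈ e} C)
    (fun C C' h => hF (openEdgeCluster_mono h x))
    (by
      intro C C' h
      show ind {E : Set (Sym2 V) | o = v ∨ ∃ e ∈ E, o ∈ e} C ≤ ind {E : Set (Sym2 V) | o = v ∨ ∃ e ∈ E, o ∈ e} C'
      by_cases hC : C ∈ {E : Set (Sym2 V) | o = v ∨ ∃ e ∈ E, o ∈ e}
      · rw [ind_of_mem hC, ind_of_mem (show C' ∈ {E : Set (Sym2 V) | o = v ∨ ∃ e ∈ E, o ∈ e} from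
          hC.elim Or.inl fun ⟨e, he, hoe⟩ => Or.inr ⟨e, h he, hoe⟩)]
      · rw [ind_of_not_mem hC]; exact ind_nonneg _ _)
  rw [hDeq] at neg
  have e1 : ∀ ω, F (openEdgeCluster (⋃ s ∈ S, openEdgeCluster ω s) x) = f ω := fun ω => by
    simp only [hf]; rw [openEdgeCluster_biUnion_eq ω S hx]
  have e2 : ∀ ω, ind {E : Set (Sym2 V) | o = v ∨ ∃ e ∈ E, o ∈ e} (⋃ t ∈ ({v} : Set V), openEdgeCluster ω t) =
      Ov.indicator 1 ω := by
    intro ω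
    have hunion : (⋃ t ∈ ({v} : Set V), openEdgeCluster ω t) = openEdgeCluster ω v := by
      ext e; simp
    rw [hunion]
    by_cases h : (openGraph ω).Reachable v o
    · rw [ind_of_mem (show openEdgeCluster ω v ∈ {E : Set (Sym2 V) | o = v ∨ ∃ e ∈ E, o ∈ e} from
        (reachable_iff_exists_mem_openEdgeCluster ω v o).1 h),
        Set.indicator_of_mem (show ω ∈ Ov from h.symm), Pi.one_apply]
    · rw [ind_of_not_mem (show openEdgeCluster ω v ∉ {E : Set (Sym2 V) | o = v ∨ ∃ e ∈ E, o ∈ e} from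
        fun hh => h ((reachable_iff_exists_mem_openEdgeCluster ω v o).2 hh)),
        Set.indicator_of_notMem (show ω ∉ Ov from fun hh => h (hh : (openGraph ω).Reachable o v).symm)]
  simp only [e1, e2] at neg
  have i1 : ∫ ω in D, f ω * Ov.indicator 1 ω ∂μ = ∫ ω in Ov ∩ D, f ω ∂μ := by
    have e : (fun ω => f ω * Ov.indicator (1 : BondConfig V → ℝ) ω) = Ov.indicator f := by
      funext ω
      by_cases hω : ω ∈ Ov
      · rw [Set.indicator_of_mem hω, Set.indicator_of_mem hω, Pi.one_apply, mul_one]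
      · rw [Set.indicator_of_notMem hω, Set.indicator_of_notMem hω, mul_zero]
    rw [e, setIntegral_indicator (hmeas Ov), Set.inter_comm]
  have i2 : ∫ ω in D, Ov.indicator (1 : BondConfig V → ℝ) ω ∂μ = μ.real (Ov ∩ D) := by
    rw [setIntegral_indicator (hmeas Ov), Set.inter_comm]
    simp only [Pi.one_apply]
    rw [setIntegral_const, smul_eq_mul, mul_one]
  rw [← hμ] at neg
  rw [i1, i2] at neg
  -- bookkeeping
  have iU : ∫ ω in U, f ω ∂μ = (∫ ω in OS, f ω ∂μ) + ∫ ω in Ov ∩ D, f ω ∂μ := by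
    rw [hUeq]; exact setIntegral_union hdisj (hmeas _) (hint _) (hint _)
  have mU : μ.real U = μ.real OS + μ.real (Ov ∩ D) := by
    rw [hUeq]; exact measureReal_union hdisj (hmeas _)
  have iV : ∫ ω in VS, f ω ∂μ = (∫ ω, f ω ∂μ) - ∫ ω in D, f ω ∂μ := by
    have := integral_add_compl (hmeas D) (Integrable.of_finite (f := f) (μ := μ))
    rw [hVD]; linarith
  have mV : μ.real VS = 1 - μ.real D := by
    have := measureReal_add_measureReal_compl (μ := μ) (hmeas D)
    rw [probReal_univ] at this
    rw [hVD]; linarith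
  have mc : μ.real (D ∩ Ov) = μ.real (Ov ∩ D) := by rw [Set.inter_comm]
  rw [mc, iV, mV]
  have hD0 : 0 ≤ μ.real D := measureReal_nonneg
  have H0 : 0 ≤ (∫ ω in OS, f ω ∂μ) - ((∫ ω, f ω ∂μ) * μ.real U - ∫ ω in Ov ∩ D, f ω ∂μ) := by linarith
  have key : μ.real D * ((∫ ω in OS, f ω ∂μ) - μ.real OS * ∫ ω, f ω ∂μ) -
      μ.real (Ov ∩ D) * (((∫ ω, f ω ∂μ) - ∫ ω in D, f ω ∂μ) - (1 - μ.real D) * ∫ ω, f ω ∂μ) =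
      μ.real D * ((∫ ω in OS, f ω ∂μ) - ((∫ ω, f ω ∂μ) * μ.real U - ∫ ω in Ov ∩ D, f ω ∂μ)) +
        ((∫ ω in D, f ω ∂μ) * μ.real (Ov ∩ D) - μ.real D * ∫ ω in Ov ∩ D, f ω ∂μ) := by
    rw [mU]; ring
  nlinarith [mul_nonneg hD0 H0, neg, key]



/-! ### The world-wise set-4PT in `delE` form and the H-part -/

/-- A `delE`-expectation is an expectation under the weights zeroed on the deleted pairs. [folklore] -/
theorem delE_eq_integral_zeroed (q : Sym2 V → unitInterval) (B : Set (Sym2 V)) (φ : Set (Sym2 V) → ℝ) :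
    delE (fun e => (q e : ℝ)) B φ = ∫ ω, φ ω ∂(prodBernoulli fun e => if e ∈ B then 0 else q e) := by
  rw [integral_prodBernoulli_eq_sum, delE, sum_weight_mul_comp_sdiff]
  refine Finset.sum_congr rfl fun η _ => ?_
  congr 2
  funext e
  split_ifs <;> rfl

/-- A positive-probability event in every world: the empty configuration lies in `{v ↮ S}` (`v ∉ S`), and all weights are `< 1`. [folklore] -/
theorem delE_ind_pos_of_empty_mem (w : Sym2 V → ℝ) (hw0 : ∀ e, 0 ≤ w e) (hw : ∀ e, w e < 1) (B : Set (Sym2 V))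
    (E : Set (BondConfig V)) (hE : (∅ : Set (Sym2 V)) ∈ E) : 0 < delE w B (ind E) := by
  have hw1 : ∀ e, w e ≤ 1 := fun e => (hw e).le
  unfold delE
  calc 0 < weight w (∅ : Set (Sym2 V)) * ind E ((∅ : Set (Sym2 V)) \ B) := by
        rw [Set.empty_sdiff, ind_of_mem hE, mul_one]; exact weight_empty_pos w hw
    _ ≤ ∑ η, weight w η * ind E (η \ B) :=
        Finset.single_le_sum (f := fun η => weight w η * ind E (η \ B))
          (fun η _ => mul_nonneg (weight_nonneg hw0 hw1 η) (ind_nonneg _ _)) (Finset.mem_univ _)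

/-- **Set-4PT in the world `G − cut_Y(ω)`** (K6 world-wise, `S = {x, d}`), `delE` form:
`delE(1{v↮S, o↔v})·covW(g, 1{v↔S}) ≤ delE(1{v↮S})·covW(g, 1{o↔S})`. [cite: VandenbergHaggstromKahn2005, Thm. 1.5 (p. 7) — corollary] -/
theorem world_setFourPT (q : Sym2 V → unitInterval) (x d o v : V) (Y : Set V) (g : Set (Sym2 V) → ℝ)
    (hg : Monotone g) (hg0 : ∀ C, 0 ≤ g C) (ω : Set (Sym2 V)) :
    delE (fun e => (q e : ℝ)) (cut Y ω)
        (ind ({ζ : BondConfig V | ∀ s ∈ ({x, d} : Set V), ¬ (openGraph ζ).Reachable s v} ∩ openConn o v)) *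
        covW (fun e => (q e : ℝ)) Y (fun η => g (openEdgeCluster η x))
          (ind {ζ : BondConfig V | ∃ s ∈ ({x, d} : Set V), (openGraph ζ).Reachable s v}) ω ≤
      delE (fun e => (q e : ℝ)) (cut Y ω) (ind {ζ : BondConfig V | ∀ s ∈ ({x, d} : Set V), ¬ (openGraph ζ).Reachable s v}) *
        covW (fun e => (q e : ℝ)) Y (fun η => g (openEdgeCluster η x))
          (ind {ζ : BondConfig V | ∃ s ∈ ({x, d} : Set V), (openGraph ζ).Reachable s o}) ω := by
  set qB : Sym2 V → unitInterval := fun e => if e ∈ cut Y ω then 0 else q e with hqB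
  have key := setFourPT_edge qB ({x, d} : Set V) o v x (by simp) g hg hg0
  have conv : ∀ φ : Set (Sym2 V) → ℝ, delE (fun e => (q e : ℝ)) (cut Y ω) φ = ∫ ζ, φ ζ ∂(prodBernoulli qB) :=
    fun φ => delE_eq_integral_zeroed q (cut Y ω) φ
  have creal : ∀ E : Set (BondConfig V), (prodBernoulli qB).real E = delE (fun e => (q e : ℝ)) (cut Y ω) (ind E) := by
    intro E; rw [conv, measureReal_eq_sum, integral_prodBernoulli_eq_sum]
  have cint : ∀ E : Set (BondConfig V), ∫ ζ in E, g (openEdgeCluster ζ x) ∂(prodBernoulli qB) =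
      delE (fun e => (q e : ℝ)) (cut Y ω) (fun η => g (openEdgeCluster η x) * ind E η) := by
    intro E; rw [conv, setIntegral_eq_sum, integral_prodBernoulli_eq_sum]
  have cint0 : ∫ ζ, g (openEdgeCluster ζ x) ∂(prodBernoulli qB) = delE (fun e => (q e : ℝ)) (cut Y ω) (fun η => g (openEdgeCluster η x)) :=
    (conv _).symm
  rw [creal, creal, creal, creal, cint, cint, cint0] at key
  simp only [covW]
  have e1 : ∀ E : Set (BondConfig V), delE (fun e => (q e : ℝ)) (cut Y ω) (fun η => g (openEdgeCluster η x) * ind E η) -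
      delE (fun e => (q e : ℝ)) (cut Y ω) (ind E) * delE (fun e => (q e : ℝ)) (cut Y ω) (fun η => g (openEdgeCluster η x)) =
      delE (fun e => (q e : ℝ)) (cut Y ω) (fun η => g (openEdgeCluster η x) * ind E η) -
      delE (fun e => (q e : ℝ)) (cut Y ω) (fun η => g (openEdgeCluster η x)) * delE (fun e => (q e : ℝ)) (cut Y ω) (ind E) :=
    fun E => by ring
  rw [← e1, ← e1]
  exact key

/-- **The H-part is nonnegative** (Lemma H of prim-hp-8, k = 1): world-wise set-4PT plus the diagonal A2/T_A inequality (Htw),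
taken here as a hypothesis in `delE` form.  [cite: VandenbergHaggstromKahn2005, Thm. 1.5 (p. 7) — corollary] -/
theorem hpart_nonneg (q : Sym2 V → unitInterval) (hq : ∀ e, (q e : ℝ) < 1) (x d o v : V) (Y : Set V)
    (hvx : v ≠ x) (hvd : v ≠ d) (p : ℝ) (g : Set (Sym2 V) → ℝ) (hg : Monotone g) (hg0 : ∀ C, 0 ≤ g C)
    (HTW : 0 ≤ ∑ ω, weight (fun e => (q e : ℝ)) ω * (ind (avoidEv x Y) ω *
      ((delE (fun e => (q e : ℝ)) (cut Y ω)
            (ind ({ζ : BondConfig V | ∀ s ∈ ({x, d} : Set V), ¬ (openGraph ζ).Reachable s v} ∩ openConn o v)) /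
          delE (fun e => (q e : ℝ)) (cut Y ω)
            (ind {ζ : BondConfig V | ∀ s ∈ ({x, d} : Set V), ¬ (openGraph ζ).Reachable s v}) - p) *
        covW (fun e => (q e : ℝ)) Y (fun η => g (openEdgeCluster η x))
          (ind {ζ : BondConfig V | ∃ s ∈ ({x, d} : Set V), (openGraph ζ).Reachable s v}) ω))) :
    0 ≤ wsum (fun e => (q e : ℝ)) x Y (fun η => g (openEdgeCluster η x))
          (ind {ζ : BondConfig V | ∃ s ∈ ({x, d} : Set V), (openGraph ζ).Reachable s o}) -
        p * wsum (fun e => (q e : ℝ)) x Y (fun η => g (openEdgeCluster η x))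
          (ind {ζ : BondConfig V | ∃ s ∈ ({x, d} : Set V), (openGraph ζ).Reachable s v}) := by
  set ŵ : Sym2 V → ℝ := fun e => (q e : ℝ) with hŵ
  have hw0 : ∀ e, 0 ≤ ŵ e := fun e => (q e).2.1
  have hw1 : ∀ e, ŵ e ≤ 1 := fun e => (q e).2.2
  set Dv : Set (BondConfig V) := {ζ : BondConfig V | ∀ s ∈ ({x, d} : Set V), ¬ (openGraph ζ).Reachable s v} with hDv
  have hpos : ∀ ω : Set (Sym2 V), 0 < delE ŵ (cut Y ω) (ind Dv) := by
    intro ω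
    refine delE_ind_pos_of_empty_mem ŵ hw0 hq (cut Y ω) Dv ?_
    intro s hs h
    rw [reachable_empty_iff] at h
    rcases hs with rfl | hs
    · exact hvx h.symm
    · rw [Set.mem_singleton_iff] at hs; subst hs; exact hvd h.symm
  -- termwise: covW(J_o) − p covW(J_v) = (covW(J_o) − pW covW(J_v)) + (pW − p) covW(J_v), first ≥ 0 by world 4PT
  rw [wsum, wsum, Finset.mul_sum, ← Finset.sum_sub_distrib]
  have split : ∀ ω : Set (Sym2 V),
      weight ŵ ω * (ind (avoidEv x Y) ω * covW ŵ Y (fun η => g (openEdgeCluster η x))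
        (ind {ζ : BondConfig V | ∃ s ∈ ({x, d} : Set V), (openGraph ζ).Reachable s o}) ω) -
      p * (weight ŵ ω * (ind (avoidEv x Y) ω * covW ŵ Y (fun η => g (openEdgeCluster η x))
        (ind {ζ : BondConfig V | ∃ s ∈ ({x, d} : Set V), (openGraph ζ).Reachable s v}) ω)) =
      weight ŵ ω * ind (avoidEv x Y) ω *
        (covW ŵ Y (fun η => g (openEdgeCluster η x))
            (ind {ζ : BondConfig V | ∃ s ∈ ({x, d} : Set V), (openGraph ζ).Reachable s o}) ω -
          delE ŵ (cut Y ω) (ind (Dv ∩ openConn o v)) / delE ŵ (cut Y ω) (ind Dv) *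
            covW ŵ Y (fun η => g (openEdgeCluster η x))
              (ind {ζ : BondConfig V | ∃ s ∈ ({x, d} : Set V), (openGraph ζ).Reachable s v}) ω) +
      weight ŵ ω * (ind (avoidEv x Y) ω *
        ((delE ŵ (cut Y ω) (ind (Dv ∩ openConn o v)) / delE ŵ (cut Y ω) (ind Dv) - p) *
          covW ŵ Y (fun η => g (openEdgeCluster η x))
            (ind {ζ : BondConfig V | ∃ s ∈ ({x, d} : Set V), (openGraph ζ).Reachable s v}) ω)) := fun ω => by ring
  rw [Finset.sum_congr rfl fun ω _ => split ω, Finset.sum_add_distrib]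
  refine add_nonneg (Finset.sum_nonneg fun ω _ => mul_nonneg (mul_nonneg (weight_nonneg hw0 hw1 ω) (ind_nonneg _ _)) ?_) HTW
  have h4 := world_setFourPT q x d o v Y g hg hg0 ω
  rw [sub_nonneg, div_mul_eq_mul_div, div_le_iff₀ (hpos ω)]
  linarith [h4]

end CSHCell

end HullPort

end Summit.CriticalPhenomena.PercolationContinuityZ3.Theorems
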